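import Mathlib.GroupTheory.Index
import Mathlib.GroupTheory.DoubleCoset
import Mathlib.GroupTheory.GroupAction.ConjAct
import Mathlib.Algebra.Group.Subgroup.Pointwise
import HarnessLib

/-!
# Group-theoretic core of [SemiAnbd] Remark 2.4.1 (aloof / estranged along finite étale coverings)

Mochizuki, *Semi-graphs of anabelioids*, Publ. RIMS **42** (2006) 221–322, §2, Remark 2.4.1,
author's manuscript p. 26 [cite: MochizukiSemiAnbd2006, Rem. 2.4.1 p.26]: "one verifies easily that
if `𝒢' → 𝒢` is a finite étale covering, and … `e'` is a(n) … edge of `𝒢'` that maps to a(n) … aloof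
edge `e`; estranged edge `e` of `𝒢`, then … `e'` is itself … aloof; estranged."

PROOF-ONLY, Mathlib-only (abc-iut, L3 row `SemiAnbd:Rmk2.4.1-covering`; statements of
`Coverticial.lean` untouched).  Along a finite étale covering the fundamental group `Π_{v'}` of a
constituent of `𝒢'` embeds in `Π_v` and each branch subgroup `Π_{b'}` lands in a FINITE-INDEX
subgroup of a conjugate `g₀ Π_b g₀⁻¹`, distinct branches of `𝒢'` over the same branch `b` giving
distinct double cosets `Π_{v'} g₀ Π_b`.  Modulo that dictionary (covering theory of `B(𝒢)`, not yet
in the tree) the aloof / estranged conjuncts of `remark_2_4_1_covering` are the following pieces of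
finite-index bookkeeping, recorded here for arbitrary groups:

* `relIndex_inf_eq_zero_of_le_of_relIndex_ne_zero` — "infinite index of `Π_b ∩ g Π_{b̃} g⁻¹` in
  `Π_b`" passes to a finite-index subgroup `A' ≤ Π_b` and any smaller second factor;
* `inf_eq_bot_of_le_of_le` — "trivial intersection" passes to subgroups;
* `relIndex_inf_map_of_injective`, `map_inf_eq_bot_iff_of_injective` — both conditions are
  invariant under an injective homomorphism (`Π_{v'} ↪ Π_v`);
* `relIndex_conjAct_smul`, `conjAct_smul_inf_relIndex`, `conjAct_smul_inf_eq_bot_iff` — normalising the conjugates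
  (`g₀ Π_b g₀⁻¹ ∩ k Π_{b̃} k⁻¹` versus `Π_b ∩ (g₀⁻¹ k) Π_{b̃} (g₀⁻¹ k)⁻¹`);
* `inv_mul_mul_not_mem_of_doubleCoset_ne` — distinct double cosets `V g₀ B ≠ V g₁ B` and `g ∈ V`
  force `g₀⁻¹ g g₁ ∉ B` (this is what feeds the clause "`b′ = b` and `g ∉ Π_b`" of Def. 2.4 (iv)
  for two distinct branches of `𝒢'` over the same branch of `𝒢`).
-/

namespace Literature.AnabelianGeometry.SemiGraphs

open scoped Pointwise

section GroupTheory

variable {G G' : Type*} [Group G] [Group G']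

/-- Infinite index of an intersection is inherited downwards: if `A ∩ C` has infinite index in `A`,
`A' ≤ A` has FINITE index in `A` and `C' ≤ C`, then `A' ∩ C'` has infinite index in `A'` (the
"aloof" clause of [SemiAnbd] Def. 2.4 (iv) along a finite étale covering, Rem. 2.4.1).
[cite: MochizukiSemiAnbd2006, Rem. 2.4.1 p.26] -/
theorem relIndex_inf_eq_zero_of_le_of_relIndex_ne_zero {A A' C C' : Subgroup G} (hA : A' ≤ A)
    (hfin : A'.relIndex A ≠ 0) (hC : C' ≤ C) (h : (A ⊓ C).relIndex A = 0) :
    (A' ⊓ C').relIndex A' = 0 := by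
  -- `A' ∩ C ≤ A ∩ C` has infinite index in `A`
  have h1 : (A' ⊓ C).relIndex A = 0 :=
    Subgroup.relIndex_eq_zero_of_le_left (inf_le_inf_right C hA) h
  -- `[A : A' ∩ C] = [A' : A' ∩ C] · [A : A']`, and `[A : A']` is finite
  have h2 : (A' ⊓ C).relIndex A' = 0 := by
    have hmul := Subgroup.relIndex_mul_relIndex (H := A' ⊓ C) (K := A') (L := A) inf_le_left hA
    rw [h1] at hmul
    rcases mul_eq_zero.mp hmul with h0 | h0
    · exact h0
    · exact absurd h0 hfin
  -- `A' ∩ C' ≤ A' ∩ C`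
  exact Subgroup.relIndex_eq_zero_of_le_left (inf_le_inf_left A' hC) h2

/-- Triviality of an intersection is inherited by subgroups (the "estranged" clause of
[SemiAnbd] Def. 2.4 (iv) along a finite étale covering, Rem. 2.4.1).
[cite: MochizukiSemiAnbd2006, Rem. 2.4.1 p.26] -/
theorem inf_eq_bot_of_le_of_le {A A' C C' : Subgroup G} (hA : A' ≤ A) (hC : C' ≤ C)
    (h : A ⊓ C = ⊥) : A' ⊓ C' = ⊥ :=
  eq_bot_iff.mpr ((inf_le_inf hA hC).trans h.le)

/-- The relative index of an intersection is unchanged by an injective homomorphism (transport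
along `Π_{v'} ↪ Π_v`). [cite: MochizukiSemiAnbd2006, Rem. 2.4.1 p.26] -/
theorem relIndex_inf_map_of_injective {f : G →* G'} (hf : Function.Injective f)
    (A C : Subgroup G) :
    (A.map f ⊓ C.map f).relIndex (A.map f) = (A ⊓ C).relIndex A := by
  rw [← Subgroup.map_inf_eq A C f hf, Subgroup.relIndex_map_map_of_injective _ _ hf]

/-- Triviality of an intersection is unchanged by an injective homomorphism.
[cite: MochizukiSemiAnbd2006, Rem. 2.4.1 p.26] -/
theorem map_inf_eq_bot_iff_of_injective {f : G →* G'} (hf : Function.Injective f)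
    (A C : Subgroup G) : A.map f ⊓ C.map f = ⊥ ↔ A ⊓ C = ⊥ := by
  rw [← Subgroup.map_inf_eq A C f hf, Subgroup.map_eq_bot_iff_of_injective _ hf]

/-- Membership in a conjugate subgroup, `ConjAct` form. (bookkeeping step of Rem. 2.4.1).
[cite: MochizukiSemiAnbd2006, Rem. 2.4.1 p.26] -/
theorem mem_conjAct_smul_iff {g x : G} {A : Subgroup G} :
    x ∈ ConjAct.toConjAct g • A ↔ g⁻¹ * x * g ∈ A := by
  rw [Subgroup.mem_smul_pointwise_iff_exists]
  constructor
  · rintro ⟨s, hs, rfl⟩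
    simpa [ConjAct.smul_def, mul_assoc] using hs
  · intro h
    exact ⟨g⁻¹ * x * g, h, by simp [ConjAct.smul_def, mul_assoc]⟩

/-- Conjugation distributes over intersections of subgroups. (bookkeeping step of Rem. 2.4.1).
[cite: MochizukiSemiAnbd2006, Rem. 2.4.1 p.26] -/
theorem conjAct_smul_inf (g : G) (A C : Subgroup G) :
    ConjAct.toConjAct g • (A ⊓ C) = ConjAct.toConjAct g • A ⊓ ConjAct.toConjAct g • C := by
  ext x
  simp only [Subgroup.mem_inf, mem_conjAct_smul_iff]

/-- Iterated conjugation: `g • (k • C) = (g k) • C`. (bookkeeping step of Rem. 2.4.1).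
[cite: MochizukiSemiAnbd2006, Rem. 2.4.1 p.26] -/
theorem conjAct_smul_conjAct_smul (g k : G) (C : Subgroup G) :
    ConjAct.toConjAct g • (ConjAct.toConjAct k • C) = ConjAct.toConjAct (g * k) • C := by
  rw [smul_smul, ← map_mul]

/-- Conjugation preserves relative indices. (bookkeeping step of Rem. 2.4.1).
[cite: MochizukiSemiAnbd2006, Rem. 2.4.1 p.26] -/
theorem relIndex_conjAct_smul (g : G) (H K : Subgroup G) :
    (ConjAct.toConjAct g • H).relIndex (ConjAct.toConjAct g • K) = H.relIndex K := by
  rw [Subgroup.pointwise_smul_def, Subgroup.pointwise_smul_def]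
  exact Subgroup.relIndex_map_map_of_injective H K
    (fun a b h => MulAction.injective (ConjAct.toConjAct g) (by simpa using h))

/-- A conjugate of a subgroup is trivial iff the subgroup is. (bookkeeping step of Rem. 2.4.1).
[cite: MochizukiSemiAnbd2006, Rem. 2.4.1 p.26] -/
theorem conjAct_smul_eq_bot_iff (g : G) (H : Subgroup G) :
    ConjAct.toConjAct g • H = ⊥ ↔ H = ⊥ := by
  rw [Subgroup.pointwise_smul_def]
  exact Subgroup.map_eq_bot_iff_of_injective H
    (fun a b h => MulAction.injective (ConjAct.toConjAct g) (by simpa using h))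

/-- Normalising conjugates in the "aloof" condition: the index of `g A g⁻¹ ∩ k C k⁻¹` in `g A g⁻¹`
equals the index of `A ∩ (g⁻¹ k) C (g⁻¹ k)⁻¹` in `A`. [cite: MochizukiSemiAnbd2006, Rem. 2.4.1 p.26] -/
theorem conjAct_smul_inf_relIndex (g k : G) (A C : Subgroup G) :
    (ConjAct.toConjAct g • A ⊓ ConjAct.toConjAct k • C).relIndex (ConjAct.toConjAct g • A) =
      (A ⊓ ConjAct.toConjAct (g⁻¹ * k) • C).relIndex A := by
  have hk : ConjAct.toConjAct k • C = ConjAct.toConjAct g • (ConjAct.toConjAct (g⁻¹ * k) • C) := by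
    rw [conjAct_smul_conjAct_smul, mul_inv_cancel_left]
  rw [hk, ← conjAct_smul_inf, relIndex_conjAct_smul]

/-- Normalising conjugates in the "estranged" condition. [cite: MochizukiSemiAnbd2006, Rem. 2.4.1 p.26] -/
theorem conjAct_smul_inf_eq_bot_iff (g k : G) (A C : Subgroup G) :
    ConjAct.toConjAct g • A ⊓ ConjAct.toConjAct k • C = ⊥ ↔
      A ⊓ ConjAct.toConjAct (g⁻¹ * k) • C = ⊥ := by
  have hk : ConjAct.toConjAct k • C = ConjAct.toConjAct g • (ConjAct.toConjAct (g⁻¹ * k) • C) := by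
    rw [conjAct_smul_conjAct_smul, mul_inv_cancel_left]
  rw [hk, ← conjAct_smul_inf, conjAct_smul_eq_bot_iff]

/-- Distinct double cosets separate: if `V g₀ B ≠ V g₁ B` and `g ∈ V` then `g₀⁻¹ g g₁ ∉ B` (two
distinct branches of `𝒢'` at `v'` over the same branch `b` of `𝒢` are distinct double cosets
`Π_{v'} g Π_b`, so the element relating their conjugates of `Π_b` lies outside `Π_b` — the clause
"`b′ = b` and `g ∉ Π_b`" of [SemiAnbd] Def. 2.4 (iv)). [cite: MochizukiSemiAnbd2006, Rem. 2.4.1 p.26] -/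
theorem inv_mul_mul_not_mem_of_doubleCoset_ne {V B : Subgroup G} {g g₀ g₁ : G} (hg : g ∈ V)
    (hne : DoubleCoset.doubleCoset g₀ (V : Set G) B ≠ DoubleCoset.doubleCoset g₁ (V : Set G) B) :
    g₀⁻¹ * g * g₁ ∉ B := by
  intro hB
  apply hne
  have hmem : g₁ ∈ DoubleCoset.doubleCoset g₀ (V : Set G) B :=
    DoubleCoset.mem_doubleCoset.mpr ⟨g⁻¹, V.inv_mem hg, g₀⁻¹ * g * g₁, hB, by simp [mul_assoc]⟩
  exact (DoubleCoset.doubleCoset_eq_of_mem hmem).symm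

end GroupTheory

end Literature.AnabelianGeometry.SemiGraphs
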